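import Summits.QuantumFields.YangMills.Theorems.UnitScaleTiltFluctuationComparisonRegPrGlobalSlackKernelLegAnchorCoherent
import Summits.QuantumFields.YangMills.Theorems.UnitScaleTiltFluctuationComparisonRegPrGlobalSlackKernelLegCfgFineScalesLocal
import Summits.QuantumFields.YangMills.Theorems.UnitScaleTiltFluctuationComparisonRegPrGlobalSlackLegCfgDistT3Window
import HarnessLib

/-!
# `UnitScaleTiltFluctuationComparisonRegPrGlobalSlackLegNaturalLipCore` — THE NATURAL CHART MAP `U ↦ P_{𝔤ᶜ}(vec B(Ū^{(j)})(y, c))` IS `256·L·(1 + d)·L^j`-LIPSCHITZ IN THE BONDWISE SUP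
# DISTANCE AT TWO PLAQUETTE-REGULAR FINE FIELDS OF RUNS `K` AND `K+1`, IN PRINT'S REGIME, RECORD-FREE AND WITHOUT ANY CLOSENESS OF THE TWO FIELDS (crux `FluctuationComparisonRegPrIntL`,
# stmt-QuantumFields-20520, skeleton v5kD, STUB 3⁗χ(v4); cell `pub/ym-inputs`, seat ym-inputs-p12 gen 7 = INPUT-LIST I-11 row `CfgDistCauchyΦ`, LEAD ym-ust-20520-w2 g5's named row
# «(Lip♮)-KNIT», file 1 of 2; count-neutral helper, def-free, registry untouched)

WHY.  ym-inputs-p12 g6's ✓`cfgDistCauchyΦ_naturalCoherent_of_newLevel_of_fine` (`…KernelLegAnchorCoherent` §3) reduces the two-run row (BC) `CfgDistCauchyΦ` of the natural configuration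
family with a run-coherent anchor to three displayed letters, (New), (Lip♮) and (Fine_b); LEAD ym-ust-20520-w2 g5's (B8) door carries them verbatim.  (Lip♮) says: the chart-level map
`Φ♮ K (K−n) j Y : U ↦ 𝟙[|c₋ − y|₁·2B₃θ_{b₀,p₁}(n)·x_j² ≤ ½]·P_{𝔤ᶜ}(vec B(Ū^{(j)})(y, c))` (`y = sel K j Y`, `x_j = (L^{K−n−j})⁻¹`) is legwise `L_Φ·(1 + d(c))·L^j`-Lipschitz in a distance `δ`
between run `K`'s fine minimiser and run `K+1`'s once-averaged one read on run `K`.  THIS FILE proves the record-free core of that letter at `δ :=` the bondwise sup distance, from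
GAUGE-INVARIANT data only and WITHOUT assuming the two fields close: with `ρ* := ⨆_e ‖A(e) − B(e)‖` and `ρ₀ := (16·10¹⁴·L·L^j)⁻¹` — if `ρ* ≤ ρ₀`, the two-field averaging theorem
(ym-inputs-p12 g4's ✓`norm_iter_sub_iter_le_of_plaqBound_T3`, one number) and the any-anchor (27) Lipschitz word (✓`norm_B27T_su_sub_le`, disc `ρ′ = ½`); if `ρ* > ρ₀`, print's one-field
bound (44) on BOTH loop variables (✓`norm_B27T_iter_blockAvg_le_T3_row`) is already below `L_Φ·(1 + d)·L^j·ρ₀`.  The located seams (LEAD's list): (i) `ℰp` IS `ExpMeanLog.expMeanLogSU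
(n := Fin 2)` (`abbrev`); (ii) Φ♮'s regime indicator IS the log-disc row `‖Ū^{(j)}(Γ_{y,c}) − 1‖ ≤ ½` once the plaquette smallness of the averages is read from [Balaban1985Averaging]
Prop. 2 (`BlockAveragingEMLProp2.plaqSmall_iter_blockAvg_eml_level`: `α_j = 2e·x_j²`, ym-inputs-p11's letters he3/he2) at print's plaquette clause `PlaqSmall (regThreshold F n K e)`;
(iii) the anchor need not attain the leg distance — the bound is linear in `|c₋ − y|₁ ≤ 3L(1 + d)` (p11's block geometry supplies this for any anchor of a listed block); (iv) the one
number `2·10¹⁴·L·(4L^j(ρ + 4L^j·regThreshold)) ≤ 1`: its plaquette half is ONE new window letter `8·10¹⁴·e ≤ 1` (`L^{1+2j−2(K−n)} ≤ L⁻³` at `j + 1 < K − n`), its `ρ`-half is the case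
split.  Run `K+1`'s field is read at run `K+1`, level `j+1`, through g6's transport lemmas (`fieldShift_iter_succ`, `holT_fieldShift_group`, `contourT_siteShift`,
`l1_rel_liftSite_matchBond`, `B27T_iter_succ_liftSite_matchBond`).  File 2 (`…LegNaturalLipRows`) instantiates the core at the record's two minimisers.

WHAT THIS FILE PROVES (def-free; every hypothesis inline).
* §1 tools: `norm_proj_vecE_sub_le`, `norm_sub_le_iSup_bond`, **`plaqSmall_iter_of_regThreshold`** ([B7] Prop. 2 at the T³ letters: `PlaqSmall (regThreshold F n K e) U ⟹
  PlaqSmall (2e·(L^{K−n−j})⁻²) Ū^{(j)}`, `j ≤ K − n`), **`norm_holT_iter_sub_one_le_half`** (the log-disc row `≤ ½` in Φ♮'s regime), `unitsField_toUField_fieldShift_succ`,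
  `holT_fieldShift_succ_liftSite`, `contourT_liftSite_matchBond`, `holT_iter_fieldShift_avg`, **`norm_holT_iter_fieldShift_avg_sub_one_le_half`** (the disc row for run `K+1`'s
  once-averaged field read on run `K`), **`norm_B27T_iter_fieldShift_avg_le`** ((44) for that field), arithmetic `oneNumber_of_le_rho0`, `le_lip_of_rho0_lt`.
* §2 ★ **`norm_naturalMap_sub_le_of_regular`** — THE CORE: two fine fields `A` (run `K`) and `U′` (run `K+1`), both `PlaqSmall (regThreshold F n · e)` at height `n ≤ K`, `e` inside p11's two
  [B7] Prop. 2 letters and `8·10¹⁴·e ≤ 1`, a chart level `j + 1 < K − n`, ANY anchor `y` with `|c₋ − y|₁ ≤ 3L(1 + d)`, the regime `|c₋ − y|₁·2e·x_j² ≤ ½`: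
  `‖P(vec B(Ā^{(j)})(y,c)) − P(vec B(B̄^{(j)})(y,c))‖ ≤ 256·L·(1 + d)·L^j·⨆_e ‖A(e) − B(e)‖`, `B := e₀(avg₀ U′)` read on run `K`.
HONEST FRAMING.  Compositions of ACCEPTED tree lemmas ([B7] Prop. 2 and the two-field sup theorem of the `Prop7FibreLevelSup*` lineage, print's (27)–(28)/(44) on the torus, g6's level
transport) plus arithmetic; no new estimate of the papers is asserted; nothing about which fields the row feeds or about their distance.  Nothing of [Balaban1985UV3] / [Balaban1985Averaging] /
[Balaban1985Variational] / [Balaban1987RG1] is asserted; no stub / crux / registry object touched (`--supports stmt-QuantumFields-20520`); no summit / rung / gap claim (YM₃ on T³ is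
ladder rung R3, not the Clay problem).  L-floor: none beyond `1 < L`.

References: T. Bałaban, CMP 98 (1985) 17–51 [Balaban1985Averaging] ((9)–(13) pp.18–19, Prop. 2 (52)–(54) p.26, Prop. 4 (134)–(135) p.38, Prop. 6 (164) p.43); CMP 102 (1985) 255–275
[Balaban1985UV3] ((27)–(28) p.263, (43)–(44) pp.266–267); CMP 102 (1985) 277–309 [Balaban1985Variational] ((2) p.278); CMP 109 (1987) 249–301 [Balaban1987RG1] ((0.1) p.251, (0.11) p.253,
(1.11)–(1.12) p.262).
-/

set_option autoImplicit false

noncomputable section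

open scoped Matrix.Norms.L2Operator
open Literature.MathematicalPhysics.QuantumFieldTheory.Balaban1983to89
open Literature.MathematicalPhysics.QuantumFieldTheory.Balaban1983to89.T3ContinuumYM3Torus
open Literature.MathematicalPhysics.QuantumFieldTheory.Balaban1983to89.T3UnitLawDensityEML (ℰp)
open Literature.MathematicalPhysics.QuantumFieldTheory.Balaban1983to89.T3UnitScaleTilt (θBal)
open Literature.MathematicalPhysics.QuantumFieldTheory.Balaban1983to89.T3LevelShift
open Literature.MathematicalPhysics.QuantumFieldTheory.Balaban1983to89.T3RegularMinimiser (regThreshold)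
open Literature.MathematicalPhysics.QuantumFieldTheory.Balaban1983to89.T3AlphaInputsAC (AlphaDataT3)
open Literature.MathematicalPhysics.QuantumFieldTheory.Balaban1983to89.T3AlphaPolymerSocket
open Literature.MathematicalPhysics.QuantumFieldTheory.Balaban1983to89.B10Eq27TorusAxialLog
open Literature.MathematicalPhysics.QuantumFieldTheory.Balaban1983to89.B7Prop1Explicit (l1 Letter)
open Literature.MathematicalPhysics.QuantumFieldTheory.Balaban1983to89.ExpMeanLog (expMeanLogSU deltaSU deltaSU_pos)
open Literature.MathematicalPhysics.QuantumFieldTheory.Balaban1983to89.BlockAveragingEMLProp2 (plaqSmall_iter_blockAvg_eml_level)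
open Literature.MathematicalPhysics.QuantumFieldTheory.Balaban1985CMP102
open Literature.MathematicalPhysics.QuantumFieldTheory.Balaban1985CMP102.Setting
open Summit.QuantumFields.Balaban3D.Carriers
open Summit.QuantumFields.Balaban3D.Proofs.Primitives
open Summit.QuantumFields.Balaban3D.Proofs.GroupModelLieC (vecE lieC)
open Summit.QuantumFields.YangMills.Theorems
open Summit.QuantumFields.YangMills.Theorems.GlobalSlackKernelMatching
open Summit.QuantumFields.YangMills.Theorems.GlobalSlackCanonicalPolymers

namespace Summit.QuantumFields.YangMills.Theorems.GlobalSlackKernelLeg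

variable {F : T3Family}

/-! ## §1 Tools: the projection, the bondwise sup, [B7] Prop. 2 at the T³ letters, the log-disc rows in Φ♮'s regime, run `K+1`'s field read on run `K`, arithmetic -/

section Tools

/-- `‖P_{𝔤ᶜ}(vec X) − P_{𝔤ᶜ}(vec X′)‖ ≤ 2‖X − X′‖` (linearity and `norm_proj_vecE_two_le`). [folklore] -/
theorem norm_proj_vecE_sub_le (X X' : Matrix (Fin 2) (Fin 2) ℂ) :
    ‖(lieC (suGroupModel 2)).orthogonalProjectionOnto (vecE (suGroupModel 2).N X) -
        (lieC (suGroupModel 2)).orthogonalProjectionOnto (vecE (suGroupModel 2).N X')‖ ≤ 2 * ‖X - X'‖ := by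
  rw [← map_sub, ← map_sub]
  exact norm_proj_vecE_two_le _

/-- The bondwise sup distance of two finest-lattice fields dominates the distance at every bond (finitely many bonds). [folklore] -/
theorem norm_sub_le_iSup_bond {K : ℕ} (U U' : GaugeField (F.P K) 0 (Matrix.specialUnitaryGroup (Fin 2) ℂ)) (e : PBond (F.P K) 0) :
    ‖((U e : Matrix.specialUnitaryGroup (Fin 2) ℂ) : Matrix (Fin 2) (Fin 2) ℂ) - ((U' e : Matrix.specialUnitaryGroup (Fin 2) ℂ) : Matrix (Fin 2) (Fin 2) ℂ)‖ ≤
      ⨆ e' : PBond (F.P K) 0, ‖((U e' : Matrix.specialUnitaryGroup (Fin 2) ℂ) : Matrix (Fin 2) (Fin 2) ℂ) -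
        ((U' e' : Matrix.specialUnitaryGroup (Fin 2) ℂ) : Matrix (Fin 2) (Fin 2) ℂ)‖ :=
  le_ciSup (Finite.bddAbove_range fun e' : PBond (F.P K) 0 => ‖((U e' : Matrix.specialUnitaryGroup (Fin 2) ℂ) : Matrix (Fin 2) (Fin 2) ℂ) -
    ((U' e' : Matrix.specialUnitaryGroup (Fin 2) ℂ) : Matrix (Fin 2) (Fin 2) ℂ)‖) e

/-- **[B7] PROP. 2 AT THE T³ LETTERS**: if the finest-lattice field `U` of run `K` satisfies print's plaquette clause `|U(∂p) − 1| < e·L^{−2(K−n)}` (`PlaqSmall (regThreshold F n K e) U`) with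
`e` inside Prop. 2's two smallness letters, then for `j ≤ K − n` the `j`-fold `ℰp`-average satisfies `|Ū^{(j)}(∂p′) − 1| < 2e·(L^{K−n−j})⁻²` («|U_k^j(∂p′) − 1| < 4L²B₃g p (Lʲη)²»).
[cite: Balaban1985Averaging, Prop. 2 (52)-(54) p.26; Balaban1985UV3, (44) p.267; Balaban1985Variational, (2) p.278] -/
theorem plaqSmall_iter_of_regThreshold {n K : ℕ} {e : ℝ} (he : 0 < e)
    (he3 : (143 * ((((3 + 4 : ℕ) : ℝ)) ^ 2 / 4) ^ 2) * e ≤ 1 / 3)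
    (he2 : 2 * e ≤ 2 * deltaSU (Fin 2) / (((3 + 4) * F.L : ℕ) : ℝ) ^ 2)
    {U : GaugeField (F.P K) 0 (Matrix.specialUnitaryGroup (Fin 2) ℂ)} (hU : PlaqSmall (regThreshold F n K e) U)
    {j : ℕ} (hj : j ≤ K - n) :
    PlaqSmall (2 * e * (((F.L : ℝ) ^ (K - n - j))⁻¹) ^ 2)
      (Averaging.iter (fun i => BlockAveraging.blockAvg (P := F.P K) (j := i) ℰp) j U) := by
  have key := pow_mul_inv_pow_eq F (n := n) (K := K) hj
  have h52 : PlaqSmall (e * ((((F.P K).L : ℝ) ^ (K - n))⁻¹) ^ 2) U := by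
    intro p
    convert hU p using 2
    rw [regThreshold, ← inv_pow, ← pow_mul, mul_comm 2]
    rfl
  have h := plaqSmall_iter_blockAvg_eml_level (P := F.P K) (n := Fin 2) (K - n) he he3 he2 h52 hj
  rw [show ((F.P K).L : ℝ) = F.L from rfl, key] at h
  exact h

/-- **THE LOG-DISC ROW IN Φ♮'s REGIME**: under the same hypotheses, at an anchor `y` and a leg `c` with `|c₋ − y|₁·2e·(L^{K−n−j})⁻² ≤ ½` the contour holonomy of (27) of `Ū^{(j)}` is within
`½` of `1` (the torus (28) lemma `norm_holT_contourT_sub_one_le_of_plaqBound`). [cite: Balaban1985UV3, (27)-(28) p.263, (44) p.267; Balaban1985Averaging, Prop. 2 (54) p.26] -/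
theorem norm_holT_iter_sub_one_le_half {n K : ℕ} {e : ℝ} (he : 0 < e)
    (he3 : (143 * ((((3 + 4 : ℕ) : ℝ)) ^ 2 / 4) ^ 2) * e ≤ 1 / 3)
    (he2 : 2 * e ≤ 2 * deltaSU (Fin 2) / (((3 + 4) * F.L : ℕ) : ℝ) ^ 2)
    {U : GaugeField (F.P K) 0 (Matrix.specialUnitaryGroup (Fin 2) ℂ)} (hU : PlaqSmall (regThreshold F n K e) U)
    {j : ℕ} (hj : j ≤ K - n) (y : Site (F.P K) j) (c : PBond (F.P K) j)
    (hreg : (l1 (rel y c.src) : ℝ) * (2 * e * (((F.L : ℝ) ^ (K - n - j))⁻¹) ^ 2) ≤ 1 / 2) :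
    ‖((holT (unitsField (toUField (Averaging.iter (fun i => BlockAveraging.blockAvg (P := F.P K) (j := i) ℰp) j U))) y (contourT y c) :
        (Matrix (Fin 2) (Fin 2) ℂ)ˣ) : Matrix (Fin 2) (Fin 2) ℂ) - 1‖ ≤ 1 / 2 :=
  (norm_holT_contourT_sub_one_le_of_plaqBound _ (by positivity) (fun p => (plaqSmall_iter_of_regThreshold he he3 he2 hU hj p).le) y c).trans hreg

/-- Reading an `SU(N)` field in the units of `M_N(ℂ)` commutes with the level identification of the two runs (both are pointwise). [cite: Balaban1987RG1, (0.1) p.251] -/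
theorem unitsField_toUField_fieldShift_succ (K b : ℕ) {N : ℕ} (X : GaugeField (F.P (K + 1)) (b + 1) (Matrix.specialUnitaryGroup (Fin N) ℂ)) :
    unitsField (toUField (fieldShift (F.sitesPerDir_eq (m := F.m) (K := K) (j := b) (m' := F.m) (K' := K + 1) (j' := b + 1) (by omega)) X)) =
      fieldShift (F.sitesPerDir_eq (m := F.m) (K := K) (j := b) (m' := F.m) (K' := K + 1) (j' := b + 1) (by omega)) (unitsField (toUField X)) :=
  rfl

/-- Transports of a run-`K+1` level-`(b+1)` field read on run `K`'s level `b` are its transports from the lifted site (`holT_fieldShift_group`). [cite: Balaban1987RG1, (0.1) p.251] -/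
theorem holT_fieldShift_succ_liftSite {G : Type*} [Group G] (K b : ℕ) (V' : GaugeField (F.P (K + 1)) (b + 1) G) (y : Site (F.P K) b) (w : List (Letter 3)) :
    holT (fieldShift (F.sitesPerDir_eq (m := F.m) (K := K) (j := b) (m' := F.m) (K' := K + 1) (j' := b + 1) (by omega)) V') y w = holT V' (liftSite F K b y) w :=
  holT_fieldShift_group _ V' y w

/-- The (27) contour word from the lifted anchor and the matched bond is the same word (`contourT_siteShift`). [cite: Balaban1985UV3, (27) p.263; Balaban1987RG1, (0.1) p.251] -/
theorem contourT_liftSite_matchBond (K b : ℕ) (y : Site (F.P K) b) (c : PBond (F.P K) b) :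
    contourT (liftSite F K b y) (matchBond F K b c) = contourT y c :=
  contourT_siteShift (F.sitesPerDir_eq (m := F.m) (K := K) (j := b) (m' := F.m) (K' := K + 1) (j' := b + 1) (by omega)) y c

/-- **RUN `K+1`'s ONCE-AVERAGED FIELD READ ON RUN `K`**: the contour holonomies of the `j`-fold average of `e₀(avg₀ U′)` at `(y, w)` are those of the `(j+1)`-fold average of `U′` at the
lifted anchor (`fieldShift_iter_succ`). [cite: Balaban1987RG1, (0.1) p.251, (0.11) p.253; Balaban1985UV3, (27) p.263] -/
theorem holT_iter_fieldShift_avg (K j : ℕ) (U' : GaugeField (F.P (K + 1)) 0 (Matrix.specialUnitaryGroup (Fin 2) ℂ)) (y : Site (F.P K) j) (w : List (Letter 3)) :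
    holT (unitsField (toUField (Averaging.iter (fun i => BlockAveraging.blockAvg (P := F.P K) (j := i) ℰp) j
        (fieldShift (F.sitesPerDir_eq (m := F.m) (K := K) (j := 0) (m' := F.m) (K' := K + 1) (j' := 1) (by omega))
          ((BlockAveraging.blockAvg (P := F.P (K + 1)) (j := 0) ℰp).avg U'))))) y w =
      holT (unitsField (toUField (Averaging.iter (fun i => BlockAveraging.blockAvg (P := F.P (K + 1)) (j := i) ℰp) (j + 1) U')))
        (liftSite F K j y) w := by
  rw [← fieldShift_iter_succ K j ℰp U']
  exact holT_fieldShift_succ_liftSite K j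
    (unitsField (toUField (Averaging.iter (fun i => BlockAveraging.blockAvg (P := F.P (K + 1)) (j := i) ℰp) (j + 1) U'))) y w

/-- **THE LOG-DISC ROW FOR RUN `K+1`'s ONCE-AVERAGED MINIMISER READ ON RUN `K`**: if `U′` on run `K+1`'s finest lattice satisfies `PlaqSmall (regThreshold F n (K+1) e) U′` (same `e`), then
for `j + 1 ≤ K + 1 − n`, in Φ♮'s regime at `(y, c)`, the contour holonomy of the `j`-fold average of `e₀(avg₀ U′)` is within `½` of `1` — the row at run `K+1`, level `j+1`, lifted anchor and
matched bond (`contourT_siteShift`, `l1_rel_liftSite_matchBond`). [cite: Balaban1985UV3, (27)-(28) p.263, (44) p.267; Balaban1987RG1, (0.1) p.251, (0.11) p.253] -/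
theorem norm_holT_iter_fieldShift_avg_sub_one_le_half {n K : ℕ} {e : ℝ} (he : 0 < e)
    (he3 : (143 * ((((3 + 4 : ℕ) : ℝ)) ^ 2 / 4) ^ 2) * e ≤ 1 / 3)
    (he2 : 2 * e ≤ 2 * deltaSU (Fin 2) / (((3 + 4) * F.L : ℕ) : ℝ) ^ 2)
    {U' : GaugeField (F.P (K + 1)) 0 (Matrix.specialUnitaryGroup (Fin 2) ℂ)} (hU' : PlaqSmall (regThreshold F n (K + 1) e) U')
    {j : ℕ} (hj : j + 1 ≤ K + 1 - n) (y : Site (F.P K) j) (c : PBond (F.P K) j)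
    (hreg : (l1 (rel y c.src) : ℝ) * (2 * e * (((F.L : ℝ) ^ (K - n - j))⁻¹) ^ 2) ≤ 1 / 2) :
    ‖((holT (unitsField (toUField (Averaging.iter (fun i => BlockAveraging.blockAvg (P := F.P K) (j := i) ℰp) j
        (fieldShift (F.sitesPerDir_eq (m := F.m) (K := K) (j := 0) (m' := F.m) (K' := K + 1) (j' := 1) (by omega))
          ((BlockAveraging.blockAvg (P := F.P (K + 1)) (j := 0) ℰp).avg U'))))) y (contourT y c) :
        (Matrix (Fin 2) (Fin 2) ℂ)ˣ) : Matrix (Fin 2) (Fin 2) ℂ) - 1‖ ≤ 1 / 2 := by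
  have hreg' : (l1 (rel (liftSite F K j y) (matchBond F K j c).src) : ℝ) * (2 * e * (((F.L : ℝ) ^ (K + 1 - n - (j + 1)))⁻¹) ^ 2) ≤ 1 / 2 := by
    rw [l1_rel_liftSite_matchBond, show K + 1 - n - (j + 1) = K - n - j by omega]; exact hreg
  have h := norm_holT_iter_sub_one_le_half he he3 he2 hU' hj (liftSite F K j y) (matchBond F K j c) hreg'
  rw [contourT_liftSite_matchBond, ← holT_iter_fieldShift_avg K j U' y (contourT y c)] at h
  exact h

/-- **PRINT'S (44) FOR RUN `K+1`'s ONCE-AVERAGED MINIMISER READ ON RUN `K`** (in Φ♮'s regime): `‖B(·)(y, c)‖ ≤ 4e·|c₋ − y|₁·(L^{K−n−1−j})⁻²` — `norm_B27T_iter_blockAvg_le_T3_row` at run `K+1`,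
level `j+1`, transported by `B27T_iter_succ_liftSite_matchBond`. [cite: Balaban1985UV3, (44) p.267; Balaban1987RG1, (0.1) p.251, (0.11) p.253] -/
theorem norm_B27T_iter_fieldShift_avg_le {n K : ℕ} {e : ℝ} (he : 0 < e)
    (he3 : (143 * ((((3 + 4 : ℕ) : ℝ)) ^ 2 / 4) ^ 2) * e ≤ 1 / 3)
    (he2 : 2 * e ≤ 2 * deltaSU (Fin 2) / (((3 + 4) * F.L : ℕ) : ℝ) ^ 2)
    {U' : GaugeField (F.P (K + 1)) 0 (Matrix.specialUnitaryGroup (Fin 2) ℂ)} (hU' : PlaqSmall (regThreshold F n (K + 1) e) U')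
    {j : ℕ} (hj : j + 1 ≤ K + 1 - n) (y : Site (F.P K) j) (c : PBond (F.P K) j)
    (hreg : (l1 (rel y c.src) : ℝ) * (2 * e * (((F.L : ℝ) ^ (K - n - j))⁻¹) ^ 2) ≤ 1 / 2) :
    ‖B27T (unitsField (toUField (Averaging.iter (fun i => BlockAveraging.blockAvg (P := F.P K) (j := i) ℰp) j
        (fieldShift (F.sitesPerDir_eq (m := F.m) (K := K) (j := 0) (m' := F.m) (K' := K + 1) (j' := 1) (by omega))
          ((BlockAveraging.blockAvg (P := F.P (K + 1)) (j := 0) ℰp).avg U'))))) y c‖ ≤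
      4 * e * (l1 (rel y c.src) : ℝ) * (((F.L : ℝ) ^ (K - n - 1 - j))⁻¹) ^ 2 := by
  have hreg' : (l1 (rel (liftSite F K j y) (matchBond F K j c).src) : ℝ) * (2 * e * (((F.L : ℝ) ^ (K + 1 - n - (j + 1)))⁻¹) ^ 2) ≤ 1 / 2 := by
    rw [l1_rel_liftSite_matchBond, show K + 1 - n - (j + 1) = K - n - j by omega]; exact hreg
  have h := norm_B27T_iter_blockAvg_le_T3_row F he he3 he2 hU' hj (liftSite F K j y) (matchBond F K j c) hreg'
  rw [l1_rel_liftSite_matchBond, show K + 1 - n - 1 - (j + 1) = K - n - 1 - j by omega, B27T_iter_succ_liftSite_matchBond] at h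
  exact h

/-- Arithmetic of the one number of the two-field theorem: for `ρ ≤ ρ₀ = (16·10¹⁴·L·L^j)⁻¹`, `8·10¹⁴·e ≤ 1`, `j + 2 ≤ N` and `L ≥ 2`,
`2·10¹⁴·L·(4L^j(ρ + 2·2L^j·e·L^{−2N})) ≤ 1`. [folklore] -/
theorem oneNumber_of_le_rho0 {L : ℝ} (hL : 2 ≤ L) {j N : ℕ} (hjN : j + 2 ≤ N) {e ρ : ℝ} (he0 : 0 ≤ e) (heL : 8 * 10 ^ 14 * e ≤ 1)
    (hρ : ρ ≤ (16 * 10 ^ 14 * L * L ^ j)⁻¹) :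
    2 * 10 ^ 14 * L * (4 * L ^ j * (ρ + 2 * (2 * L ^ j) * (e * (L⁻¹) ^ (2 * N)))) ≤ 1 := by
  have hL0 : 0 < L := by linarith
  have hL1 : 1 ≤ L := by linarith
  have hpos : 0 < 16 * 10 ^ 14 * L * L ^ j := by positivity
  have h1 : 8 * 10 ^ 14 * L * L ^ j * ρ ≤ 1 / 2 := by
    calc 8 * 10 ^ 14 * L * L ^ j * ρ ≤ 8 * 10 ^ 14 * L * L ^ j * (16 * 10 ^ 14 * L * L ^ j)⁻¹ := mul_le_mul_of_nonneg_left hρ (by positivity)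
      _ = 1 / 2 := by field_simp; ring
  have h2 : L * L ^ j * L ^ j * (L⁻¹) ^ (2 * N) ≤ 1 / 8 := by
    have hL3 : (8 : ℝ) ≤ L ^ 3 := by
      calc (8 : ℝ) = 2 ^ 3 := by norm_num
        _ ≤ L ^ 3 := pow_le_pow_left₀ (by norm_num) hL 3
    have hpow : L * L ^ j * L ^ j * L ^ 3 ≤ L ^ (2 * N) := by
      rw [show L * L ^ j * L ^ j * L ^ 3 = L ^ (2 * j + 4) by ring]
      exact pow_le_pow_right₀ hL1 (by omega)
    have hN0 : 0 < L ^ (2 * N) := by positivity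
    rw [inv_pow, mul_inv_le_iff₀ hN0]
    nlinarith [mul_nonneg (mul_nonneg hL0.le (pow_nonneg hL0.le j)) (pow_nonneg hL0.le j)]
  have h3 : 32 * 10 ^ 14 * e * (L * L ^ j * L ^ j * (L⁻¹) ^ (2 * N)) ≤ 1 / 2 := by
    calc 32 * 10 ^ 14 * e * (L * L ^ j * L ^ j * (L⁻¹) ^ (2 * N)) ≤ 32 * 10 ^ 14 * e * (1 / 8) := mul_le_mul_of_nonneg_left h2 (by positivity)
      _ ≤ 1 / 2 := by linarith
  calc 2 * 10 ^ 14 * L * (4 * L ^ j * (ρ + 2 * (2 * L ^ j) * (e * (L⁻¹) ^ (2 * N))))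
      = 8 * 10 ^ 14 * L * L ^ j * ρ + 32 * 10 ^ 14 * e * (L * L ^ j * L ^ j * (L⁻¹) ^ (2 * N)) := by ring
    _ ≤ 1 / 2 + 1 / 2 := add_le_add h1 h3
    _ = 1 := by norm_num

/-- Arithmetic of the far case: for `ρ > ρ₀ = (16·10¹⁴·L·L^j)⁻¹`, `8·10¹⁴·e ≤ 1`, `M ≥ 1`, `|c₋ − y|₁ ≤ 3L(1 + d)` and `L ≥ 2`, twice the two (44) bounds are below
`256·L·(1 + d)·L^j·ρ`. [folklore] -/
theorem le_lip_of_rho0_lt {L : ℝ} (hL : 2 ≤ L) {j M : ℕ} (hM : 1 ≤ M) {e ρ d l : ℝ} (he0 : 0 ≤ e) (heL : 8 * 10 ^ 14 * e ≤ 1) (hd : 0 ≤ d)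
    (hl : l ≤ 3 * L * (1 + d)) (hρ : (16 * 10 ^ 14 * L * L ^ j)⁻¹ < ρ) :
    2 * (4 * e * l * ((L ^ M)⁻¹) ^ 2) + 2 * (4 * e * l * ((L ^ M)⁻¹) ^ 2) ≤ 256 * L * (1 + d) * L ^ j * ρ := by
  have hL0 : 0 < L := by linarith
  have hL1 : 1 ≤ L := by linarith
  have hx : ((L ^ M)⁻¹) ^ 2 ≤ (L⁻¹) ^ 2 :=
    pow_le_pow_left₀ (by positivity) (inv_anti₀ hL0 (le_self_pow₀ hL1 (by omega))) 2
  have hlx : l * ((L ^ M)⁻¹) ^ 2 ≤ 3 * L * (1 + d) * (L⁻¹) ^ 2 := mul_le_mul hl hx (by positivity) (by positivity)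
  have hR : 256 * L * (1 + d) * L ^ j * (16 * 10 ^ 14 * L * L ^ j)⁻¹ = 16 * (1 + d) / 10 ^ 14 := by
    field_simp
    ring
  have hρ' : 256 * L * (1 + d) * L ^ j * (16 * 10 ^ 14 * L * L ^ j)⁻¹ ≤ 256 * L * (1 + d) * L ^ j * ρ :=
    mul_le_mul_of_nonneg_left hρ.le (by positivity)
  have hLi : 3 * L * (1 + d) * (L⁻¹) ^ 2 = 3 * (1 + d) * L⁻¹ := by field_simp
  have hLinv : L⁻¹ ≤ 1 / 2 := by rw [inv_le_comm₀ hL0 (by norm_num)]; linarith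
  have hfin : 48 * (1 + d) * (e * L⁻¹) ≤ 16 * (1 + d) / 10 ^ 14 := by
    have h1d : 0 ≤ 1 + d := by linarith
    have heLinv : e * L⁻¹ ≤ e * (1 / 2) := mul_le_mul_of_nonneg_left hLinv he0
    have h48 : 48 * (e * L⁻¹) ≤ 16 / 10 ^ 14 := by linarith
    calc 48 * (1 + d) * (e * L⁻¹) = (1 + d) * (48 * (e * L⁻¹)) := by ring
      _ ≤ (1 + d) * (16 / 10 ^ 14) := mul_le_mul_of_nonneg_left h48 h1d
      _ = 16 * (1 + d) / 10 ^ 14 := by ring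
  calc 2 * (4 * e * l * ((L ^ M)⁻¹) ^ 2) + 2 * (4 * e * l * ((L ^ M)⁻¹) ^ 2) = 16 * e * (l * ((L ^ M)⁻¹) ^ 2) := by ring
    _ ≤ 16 * e * (3 * L * (1 + d) * (L⁻¹) ^ 2) := mul_le_mul_of_nonneg_left hlx (by positivity)
    _ = 48 * (1 + d) * (e * L⁻¹) := by rw [hLi]; ring
    _ ≤ 16 * (1 + d) / 10 ^ 14 := hfin
    _ = 256 * L * (1 + d) * L ^ j * (16 * 10 ^ 14 * L * L ^ j)⁻¹ := hR.symm
    _ ≤ _ := hρ'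

end Tools


/-! ## §2 The core: the natural chart map at two regular fine fields, any anchor of a block, in the regime — without (Fine_b) -/

section Core

/-- ★ **THE NATURAL CHART MAP IS `256·L·(1 + d)·L^j`-LIPSCHITZ IN THE BONDWISE SUP DISTANCE AT TWO REGULAR FINE FIELDS, RECORD-FREE.**  Data: run `K`, height `n ≤ K`, chart level
`j + 1 < K − n`; `A` on run `K`'s finest lattice and `U′` on run `K+1`'s, both inside print's plaquette clause at height `n` with constant `e` (`PlaqSmall (regThreshold F n · e)`), `e`
inside [B7] Prop. 2's two smallness letters and the new letter `8·10¹⁴·e ≤ 1`; `B := e₀(avg₀ U′)` read on run `K`; ANY anchor `y` with `|c₋ − y|₁ ≤ 3L(1 + d)`, `d ≥ 0`; the regime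
`|c₋ − y|₁·2e·(L^{K−n−j})⁻² ≤ ½`.  Conclusion: `‖P(vec B(Ā^{(j)})(y,c)) − P(vec B(B̄^{(j)})(y,c))‖ ≤ 256·L·(1 + d)·L^j·⨆_e ‖A(e) − B(e)‖`.  Proof: with `ρ* := ⨆_e ‖A(e) − B(e)‖` and
`ρ₀ := (16·10¹⁴·L·L^j)⁻¹` — if `ρ* ≤ ρ₀`, the two-field theorem (`norm_iter_sub_iter_le_of_plaqBound_T3`, one number `oneNumber_of_le_rho0`) and the any-anchor (27) Lipschitz word
(`norm_B27T_su_sub_le` at `ρ′ = ½`, disc rows `norm_holT_iter_sub_one_le_half` / `norm_holT_iter_fieldShift_avg_sub_one_le_half`); if `ρ* > ρ₀`, print's (44) on both loop variables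
(`norm_B27T_iter_blockAvg_le_T3_row`, `norm_B27T_iter_fieldShift_avg_le`) and `le_lip_of_rho0_lt`.
[cite: Balaban1985Averaging, Prop. 2 (54) p.26, Prop. 4 (134)–(135) p.38, Prop. 6 (164) p.43; Balaban1985UV3, (27)-(28) p.263, (44) p.267; Balaban1987RG1, (0.11) p.253, (1.11)–(1.12) p.262] -/
theorem norm_naturalMap_sub_le_of_regular {n K : ℕ} (hnK : n ≤ K) {j : ℕ} (hj : j + 1 < K - n) {e : ℝ} (he : 0 < e)
    (he3 : (143 * ((((3 + 4 : ℕ) : ℝ)) ^ 2 / 4) ^ 2) * e ≤ 1 / 3)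
    (he2 : 2 * e ≤ 2 * deltaSU (Fin 2) / (((3 + 4) * F.L : ℕ) : ℝ) ^ 2)
    (heL : 8 * 10 ^ 14 * e ≤ 1)
    (A : GaugeField (F.P K) 0 (Matrix.specialUnitaryGroup (Fin 2) ℂ)) (U' : GaugeField (F.P (K + 1)) 0 (Matrix.specialUnitaryGroup (Fin 2) ℂ))
    (hA : PlaqSmall (regThreshold F n K e) A) (hU' : PlaqSmall (regThreshold F n (K + 1) e) U')
    (y : Site (F.P K) j) (c : PBond (F.P K) j) {d : ℝ} (hd : 0 ≤ d) (hy : (l1 (rel y c.src) : ℝ) ≤ 3 * F.L * (1 + d))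
    (hreg : (l1 (rel y c.src) : ℝ) * (2 * e * (((F.L : ℝ) ^ (K - n - j))⁻¹) ^ 2) ≤ 1 / 2) :
    ‖(lieC (suGroupModel 2)).orthogonalProjectionOnto (vecE (suGroupModel 2).N
          (B27T (unitsField (toUField (Averaging.iter (fun i => BlockAveraging.blockAvg (P := F.P K) (j := i) ℰp) j A))) y c)) -
        (lieC (suGroupModel 2)).orthogonalProjectionOnto (vecE (suGroupModel 2).N
          (B27T (unitsField (toUField (Averaging.iter (fun i => BlockAveraging.blockAvg (P := F.P K) (j := i) ℰp) j
            (fieldShift (F.sitesPerDir_eq (m := F.m) (K := K) (j := 0) (m' := F.m) (K' := K + 1) (j' := 1) (by omega))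
              ((BlockAveraging.blockAvg (P := F.P (K + 1)) (j := 0) ℰp).avg U'))))) y c))‖ ≤
      256 * (F.L : ℝ) * (1 + d) * (F.L : ℝ) ^ j *
        ⨆ e' : PBond (F.P K) 0, ‖((A e' : Matrix.specialUnitaryGroup (Fin 2) ℂ) : Matrix (Fin 2) (Fin 2) ℂ) -
          ((fieldShift (F.sitesPerDir_eq (m := F.m) (K := K) (j := 0) (m' := F.m) (K' := K + 1) (j' := 1) (by omega))
              ((BlockAveraging.blockAvg (P := F.P (K + 1)) (j := 0) ℰp).avg U') e' : Matrix.specialUnitaryGroup (Fin 2) ℂ) : Matrix (Fin 2) (Fin 2) ℂ)‖ := by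
  -- letters
  have hL2 : (2 : ℝ) ≤ F.L := by exact_mod_cast F.hL.2
  have hL0 : (0 : ℝ) < F.L := by linarith
  have hjK : j ≤ K - n := by omega
  have hjK' : j + 1 ≤ K + 1 - n := by omega
  have hjm : j < (F.P K).m + (F.P K).K := by show j < F.m + K; omega
  have hreg0 : 0 ≤ regThreshold F n K e := by unfold regThreshold; positivity
  have hl0 : (0 : ℝ) ≤ (l1 (rel y c.src) : ℝ) := by exact_mod_cast Nat.zero_le _
  -- names
  set B : GaugeField (F.P K) 0 (Matrix.specialUnitaryGroup (Fin 2) ℂ) :=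
    fieldShift (F.sitesPerDir_eq (m := F.m) (K := K) (j := 0) (m' := F.m) (K' := K + 1) (j' := 1) (by omega))
      ((BlockAveraging.blockAvg (P := F.P (K + 1)) (j := 0) ℰp).avg U') with hBdef
  set ρ : ℝ := ⨆ e' : PBond (F.P K) 0, ‖((A e' : Matrix.specialUnitaryGroup (Fin 2) ℂ) : Matrix (Fin 2) (Fin 2) ℂ) -
    ((B e' : Matrix.specialUnitaryGroup (Fin 2) ℂ) : Matrix (Fin 2) (Fin 2) ℂ)‖ with hρdef
  have hρ0 : 0 ≤ ρ := Real.iSup_nonneg fun _ => norm_nonneg _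
  have hρe : ∀ e' : PBond (F.P K) 0, ‖((B e' : Matrix.specialUnitaryGroup (Fin 2) ℂ) : Matrix (Fin 2) (Fin 2) ℂ) -
      ((A e' : Matrix.specialUnitaryGroup (Fin 2) ℂ) : Matrix (Fin 2) (Fin 2) ℂ)‖ ≤ ρ := fun e' => by
    rw [norm_sub_rev]; exact norm_sub_le_iSup_bond A B e'
  have hRHS0 : 0 ≤ 256 * (F.L : ℝ) * (1 + d) * (F.L : ℝ) ^ j * ρ := by positivity
  rcases le_or_gt ρ (16 * 10 ^ 14 * (F.L : ℝ) * (F.L : ℝ) ^ j)⁻¹ with hρs | hρb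
  · -- near case: the two-field theorem and the (27) Lipschitz word
    have hone : 2 * 10 ^ 14 * (F.L : ℝ) * (4 * (F.L : ℝ) ^ j * (ρ + 2 * (2 * (F.L : ℝ) ^ j) * regThreshold F n K e)) ≤ 1 :=
      oneNumber_of_le_rho0 hL2 (N := K - n) (by omega) he.le heL hρs
    have hε : ∀ b : PBond (F.P K) j,
        ‖((Averaging.iter (fun i => BlockAveraging.blockAvg (P := F.P K) (j := i) ℰp) j B b : Matrix.specialUnitaryGroup (Fin 2) ℂ) : Matrix (Fin 2) (Fin 2) ℂ) -
          ((Averaging.iter (fun i => BlockAveraging.blockAvg (P := F.P K) (j := i) ℰp) j A b : Matrix.specialUnitaryGroup (Fin 2) ℂ) : Matrix (Fin 2) (Fin 2) ℂ)‖ ≤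
          8 * (F.L : ℝ) ^ j * ρ := fun b =>
      norm_iter_sub_iter_le_of_plaqBound_T3 hjm b B A hρ0 hreg0 (fun p => (hA p).le) hρe hone
    have hhA := norm_holT_iter_sub_one_le_half he he3 he2 hA hjK y c hreg
    have hhB := norm_holT_iter_fieldShift_avg_sub_one_le_half he he3 he2 hU' hjK' y c hreg
    have hdiff := norm_B27T_su_sub_le _ _ (by positivity) hε y c (by norm_num : (1 / 2 : ℝ) < 1) hhB hhA
    have hl1 : (l1 (rel y c.src) : ℝ) + 1 ≤ 4 * F.L * (1 + d) := by nlinarith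
    calc _ ≤ 2 * ‖B27T (unitsField (toUField (Averaging.iter (fun i => BlockAveraging.blockAvg (P := F.P K) (j := i) ℰp) j A))) y c -
              B27T (unitsField (toUField (Averaging.iter (fun i => BlockAveraging.blockAvg (P := F.P K) (j := i) ℰp) j B))) y c‖ :=
          norm_proj_vecE_sub_le _ _
      _ = 2 * ‖B27T (unitsField (toUField (Averaging.iter (fun i => BlockAveraging.blockAvg (P := F.P K) (j := i) ℰp) j B))) y c -
              B27T (unitsField (toUField (Averaging.iter (fun i => BlockAveraging.blockAvg (P := F.P K) (j := i) ℰp) j A))) y c‖ := by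
          rw [norm_sub_rev]
      _ ≤ 2 * ((1 - 1 / 2)⁻¹ * (2 * (l1 (rel y c.src) : ℝ) + 2) * (8 * (F.L : ℝ) ^ j * ρ)) := mul_le_mul_of_nonneg_left hdiff (by norm_num)
      _ = 64 * ((l1 (rel y c.src) : ℝ) + 1) * (F.L : ℝ) ^ j * ρ := by norm_num; ring
      _ ≤ 64 * (4 * F.L * (1 + d)) * (F.L : ℝ) ^ j * ρ := by gcongr
      _ = _ := by ring
  · -- far case: print's (44) on both loop variables
    have h44A := norm_B27T_iter_blockAvg_le_T3_row F he he3 he2 hA hjK y c hreg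
    have h44B := norm_B27T_iter_fieldShift_avg_le he he3 he2 hU' hjK' y c hreg
    calc _ ≤ ‖(lieC (suGroupModel 2)).orthogonalProjectionOnto (vecE (suGroupModel 2).N
                (B27T (unitsField (toUField (Averaging.iter (fun i => BlockAveraging.blockAvg (P := F.P K) (j := i) ℰp) j A))) y c))‖ +
            ‖(lieC (suGroupModel 2)).orthogonalProjectionOnto (vecE (suGroupModel 2).N
                (B27T (unitsField (toUField (Averaging.iter (fun i => BlockAveraging.blockAvg (P := F.P K) (j := i) ℰp) j B))) y c))‖ :=
          norm_sub_le _ _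
      _ ≤ 2 * ‖B27T (unitsField (toUField (Averaging.iter (fun i => BlockAveraging.blockAvg (P := F.P K) (j := i) ℰp) j A))) y c‖ +
            2 * ‖B27T (unitsField (toUField (Averaging.iter (fun i => BlockAveraging.blockAvg (P := F.P K) (j := i) ℰp) j B))) y c‖ :=
          add_le_add (norm_proj_vecE_two_le _) (norm_proj_vecE_two_le _)
      _ ≤ 2 * (4 * e * (l1 (rel y c.src) : ℝ) * (((F.L : ℝ) ^ (K - n - 1 - j))⁻¹) ^ 2) +
            2 * (4 * e * (l1 (rel y c.src) : ℝ) * (((F.L : ℝ) ^ (K - n - 1 - j))⁻¹) ^ 2) := by gcongr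
      _ ≤ _ := le_lip_of_rho0_lt hL2 (M := K - n - 1 - j) (by omega) he.le heL hd hy hρb

end Core

end Summit.QuantumFields.YangMills.Theorems.GlobalSlackKernelLeg

end
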